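import Mathlib
import Literature.NumberTheory.DiophantineGeometry.AVGaloisModule
import Literature.NumberTheory.DiophantineGeometry.AVGaloisModuleContinuityProofs
import Literature.AlgebraicGeometry.Motives.FaltingsAbelian
import Literature.AlgebraicGeometry.Motives.FaltingsAbelianLatticeProofs
import Literature.NumberTheory.GaloisRepresentations.GaloisRep
import Literature.RepresentationTheory.Semisimple.BurnsideMatrixSpan
import HarnessLib

/-!
# Stub `stub_tateModuleIrreducible` (line `level-three-weierstrass-switch`, crux stmt-Langlands-13640)

`B/ℚ` an abelian variety with `End_ℚ(B) = ℤ · id`, `ρ₀ : Γ_ℚ → GL₄(ℚ̄_p)` its framed `p`-adic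
`H¹ = (V_p B)^∨ ⊗ ℚ̄_p` written in the dual basis of a `ℚ_p`-basis `b` of `V_p B` (frame clause
`ρ₀(g) = ([g⁻¹]_b ⊗ ℚ̄_p)ᵀ`).  Then `ρ₀` is irreducible — GRANTED Faltings' two theorems, which are
NAMED FACTS of the tree without discharge (`Literature.AlgebraicGeometry.Motives.faltings_tate_bijective`,
Satz 4 / Korollar 1, and `Literature.AlgebraicGeometry.Motives.isSemisimpleRepresentation_rationalTateRep`,
Satz 3, file `Literature/AlgebraicGeometry/Motives/FaltingsAbelian.lean`), taken here as hypotheses.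

The chain (Faltings 1983, §5, Bemerkung after Satz 4; Curtis–Reiner (27.4), (29.13)):

1. `exists_eq_smul_id_of_faltings`: with `End_ℚ(B) = ℤ`, every `Γ_ℚ`-equivariant `ℤ_p`-linear
   endomorphism of `T_p B` is a scalar (span form of Satz 4,
   `mem_span_range_tateModuleMap_of_faltings_tate_bijective`, and `T_p(n · id) = n · id`);
2. `exists_eq_smul_id_rationalTateRep`: hence the commutant of `V_p B = ℚ_p ⊗ T_p B` is `ℚ_p`
   (bounded denominators, `RationalTateModule.exists_linearMap_toRational_apply_eq_smul`;
   equivariance descends, `smul_apply_of_toRational_apply_eq`; `T_p B` is finitely generated,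
   `module_finite_tateModule_of_cast_ne_zero`);
3. `isIrreducible_of_isSemisimpleRepresentation_of_commutant`: a semisimple
   representation on a non-zero space whose commutant is the ground field is irreducible (the
   projection onto a complemented subrepresentation is an equivariant idempotent, hence `0` or `1`);
4. `span_range_toMatrix_eq_top`: an irreducible representation with scalar
   commutant has matrices spanning `M_n(k)` (Jacobson density, the tree's
   `Representation.exists_asAlgebraHom_apply_eq`; Burnside's theorem without algebraic closure),
   i.e. it is ABSOLUTELY irreducible (`Literature/RepresentationTheory/Semisimple/BurnsideMatrixSpan`);
5. `span_range_transpose_map_inv_eq_top`: spanning `M_n` survives extension of scalars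
   (`span_range_map_eq_top_iff`), transposition and `g ↦ g⁻¹`, so the matrices `ρ₀(g)` span
   `M₄(ℚ̄_p)` and `ρ₀` is irreducible (`isIrreducible_of_span_eq_top`).

Main results: `stub_tateModuleIrreducible_of` (for the given `p`, `B`, conditional on the two
facts for `(B, p)`) and `stub_tateModuleIrreducible` (the registered signature with the two named
facts prepended as global hypotheses, fully qualified).
-/

set_option linter.dupNamespace false

noncomputable section

open CategoryTheory IsDedekindDomain
open scoped NumberField TensorProduct Matrix
open Literature.NumberTheory.GaloisRepresentations
open Literature.AlgebraicGeometry.Motives (AbelianVariety)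

namespace Summit.Langlands.Langlands.Cruxes.StableYoshidaCongruence.LevelThreeWeierstrassSwitch

/-! ## Generic representation theory: scalar commutant -/

section Commutant

variable {k G V : Type*} [Field k] [Group G] [AddCommGroup V] [Module k V]

/-- **Semisimple with scalar commutant on a non-zero space ⇒ irreducible.**  If every
subrepresentation of `ρ` has an invariant complement and every `k`-linear endomorphism of `V`
commuting with all `ρ(g)` is a scalar, then `ρ` is irreducible: for a subrepresentation `W` with
invariant complement `W'`, the projection onto `W` along `W'` commutes with `ρ`, so it is a scalar
`c`, and `W = range (c • id)` is `0` (`c = 0`) or `V` (`c ≠ 0`).  (Curtis–Reiner, *Methods of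
representation theory* I, (3.9); the converse of Schur's lemma for semisimple modules.)
[folklore] -/
theorem isIrreducible_of_isSemisimpleRepresentation_of_commutant (ρ : Representation k G V)
    [Nontrivial V] [ρ.IsSemisimpleRepresentation]
    (hs : ∀ T : V →ₗ[k] V, (∀ g : G, T ∘ₗ ρ g = ρ g ∘ₗ T) → ∃ c : k, T = c • LinearMap.id) :
    ρ.IsIrreducible := by
  have hbt : (⊥ : Subrepresentation ρ) ≠ ⊤ := fun h =>
    bot_ne_top (congrArg Subrepresentation.toSubmodule h)
  haveI : Nontrivial (Subrepresentation ρ) := ⟨⟨⊥, ⊤, hbt⟩⟩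
  refine ⟨fun W => ?_⟩
  obtain ⟨W', hWW'⟩ := exists_isCompl W
  have hc : IsCompl W.toSubmodule W'.toSubmodule := by
    refine ⟨?_, ?_⟩
    · rw [disjoint_iff]
      exact congrArg Subrepresentation.toSubmodule hWW'.inf_eq_bot
    · rw [codisjoint_iff]
      exact congrArg Subrepresentation.toSubmodule hWW'.sup_eq_top
  set P : V →ₗ[k] V := W.toSubmodule.projection W'.toSubmodule hc
  have hPcomm : ∀ g : G, P ∘ₗ ρ g = ρ g ∘ₗ P := by
    intro g
    refine LinearMap.ext fun v => ?_
    have hv : v = P v + (v - P v) := by abel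
    have h1 : ρ g (P v) ∈ W.toSubmodule :=
      W.apply_mem_toSubmodule g (Submodule.projection_apply_mem hc v)
    have h2 : ρ g (v - P v) ∈ W'.toSubmodule :=
      W'.apply_mem_toSubmodule g (Submodule.sub_projection_mem hc v)
    rw [LinearMap.comp_apply, LinearMap.comp_apply]
    conv_lhs => rw [hv, map_add, map_add]
    rw [Submodule.projection_apply_of_mem_left hc h1,
      Submodule.projection_apply_of_mem_right hc h2, add_zero]
  obtain ⟨c, hcP⟩ := hs P hPcomm
  have hrange : LinearMap.range P = W.toSubmodule := Submodule.range_projection hc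
  by_cases hc0 : c = 0
  · left
    apply Subrepresentation.toSubmodule_injective
    rw [← hrange, hcP, hc0, zero_smul, LinearMap.range_zero]
    rfl
  · right
    apply Subrepresentation.toSubmodule_injective
    rw [← hrange, hcP]
    change LinearMap.range (c • (LinearMap.id : V →ₗ[k] V)) = ⊤
    refine LinearMap.range_eq_top.2 fun v => ⟨c⁻¹ • v, ?_⟩
    rw [LinearMap.smul_apply, LinearMap.id_apply, smul_smul, mul_inv_cancel₀ hc0, one_smul]

/-- **Burnside's theorem with a given scalar commutant.**  If `ρ` is irreducible and every
`k`-linear endomorphism commuting with `ρ` is a scalar, then the matrices `[ρ(g)]_b` in any basis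
`b` span `M_n(k)`: by the Jacobson density theorem (the tree's
`Representation.exists_asAlgebraHom_apply_eq`) the group algebra `k[G]` interpolates every
endomorphism on the finitely many basis vectors, hence maps onto `End_k(V)`.  For `k`
algebraically closed the commutant hypothesis is automatic (Schur) and this is
`Literature.RepresentationTheory.Semisimple.span_eq_top_of_isIrreducible`.  (Curtis–Reiner
(27.4); Lang, *Algebra*, XVII §3, Cor. 3.4.) [folklore] -/
theorem span_range_toMatrix_eq_top {n : ℕ} (ρ : Representation k G V) [ρ.IsIrreducible]
    (b : Module.Basis (Fin n) k V)
    (hs : ∀ T : V →ₗ[k] V, (∀ g : G, T ∘ₗ ρ g = ρ g ∘ₗ T) → ∃ c : k, T = c • LinearMap.id) :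
    Submodule.span k (Set.range fun g : G => LinearMap.toMatrix b b (ρ g)) = ⊤ := by
  classical
  rw [eq_top_iff]
  rintro X -
  obtain ⟨r, hr⟩ := Representation.exists_asAlgebraHom_apply_eq (ρ := ρ) hs
    (Finset.univ.image b) (Matrix.toLin b b X)
  have hrX : ρ.asAlgebraHom r = Matrix.toLin b b X :=
    b.ext fun i => hr _ (Finset.mem_image.mpr ⟨i, Finset.mem_univ _, rfl⟩)
  have hmem : ρ.asAlgebraHom r ∈
      Submodule.span k (Set.range fun g : G => (ρ g : V →ₗ[k] V)) := by
    rw [Representation.asAlgebraHom_def, MonoidAlgebra.lift_apply, Finsupp.sum]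
    exact Submodule.sum_mem _ fun g _ => Submodule.smul_mem _ _ (Submodule.subset_span ⟨g, rfl⟩)
  have himage := Submodule.mem_map_of_mem
    (f := (LinearMap.toMatrix b b : (V →ₗ[k] V) ≃ₗ[k] Matrix (Fin n) (Fin n) k).toLinearMap) hmem
  rw [hrX, Submodule.map_span, ← Set.range_comp] at himage
  have hX : (LinearMap.toMatrix b b : (V →ₗ[k] V) ≃ₗ[k] Matrix (Fin n) (Fin n) k).toLinearMap
      (Matrix.toLin b b X) = X := LinearMap.toMatrix_toLin b b X
  rw [hX] at himage
  exact himage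

end Commutant

/-! ## Matrix spans under change of scalars, transposition and inversion -/

/-- If the matrices `X(g)`, `g ∈ G`, span `M_n(k)`, then for a field homomorphism `f : k → L`
the matrices `(f(X(g⁻¹)))ᵀ` span `M_n(L)`: spanning is insensitive to extension of scalars
(`Literature.RepresentationTheory.Semisimple.span_range_map_eq_top_iff`), `g ↦ g⁻¹` permutes the
family, and transposition is a linear automorphism of `M_n(L)`. [folklore] -/
theorem span_range_transpose_map_inv_eq_top {k L G : Type*} [Field k] [Field L] [Group G] {n : ℕ}
    (f : k →+* L) (X : G → Matrix (Fin n) (Fin n) k)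
    (h : Submodule.span k (Set.range X) = ⊤) :
    Submodule.span L (Set.range fun g : G => ((X g⁻¹).map f)ᵀ) = ⊤ := by
  have h1 : Submodule.span L (Set.range fun g : G => (X g).map f) = ⊤ :=
    (Literature.RepresentationTheory.Semisimple.span_range_map_eq_top_iff f X).2 h
  set e : Matrix (Fin n) (Fin n) L ≃ₗ[L] Matrix (Fin n) (Fin n) L :=
    Matrix.transposeLinearEquiv (Fin n) (Fin n) L L
  have h2 : (Set.range fun g : G => ((X g⁻¹).map f)ᵀ) =
      e '' (Set.range fun g : G => (X g).map f) := by
    ext M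
    constructor
    · rintro ⟨g, rfl⟩
      exact ⟨(X g⁻¹).map f, ⟨g⁻¹, rfl⟩, rfl⟩
    · rintro ⟨_, ⟨g, rfl⟩, rfl⟩
      refine ⟨g⁻¹, ?_⟩
      show ((X g⁻¹⁻¹).map f)ᵀ = e ((X g).map f)
      rw [inv_inv]
      rfl
  rw [h2, Submodule.span_image_linearEquiv, h1, Submodule.map_top, LinearEquiv.range]

/-! ## The Tate module of an abelian variety over `ℚ` with `End_ℚ = ℤ` -/

section Tate

open Literature.AlgebraicGeometry.Motives Literature.AlgebraicGeometry.Motives.AbelianVariety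
open Literature.NumberTheory.EllipticCurves

variable (p : ℕ) [Fact p.Prime] (B : AbelianVariety ℚ)

/-- `T_p` of multiplication by an integer is multiplication by that integer:
`T_p(n · 𝟙_B) = n · id` (additivity of `f ↦ T_p f`, `tateModuleMap_add`, and `T_p 𝟙 = id`). [folklore] -/
theorem tateModuleMap_zsmul_id (n : ℤ) :
    tateModuleMap p (n • 𝟙 B) =
      n • (LinearMap.id : B.tateModule p →ₗ[ℤ_[p]] B.tateModule p) := by
  let φ : (B ⟶ B) →+ (B.tateModule p →ₗ[ℤ_[p]] B.tateModule p) :=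
    { toFun := tateModuleMap p
      map_zero' := tateModuleMap_zero p
      map_add' := tateModuleMap_add p }
  have h : φ (n • 𝟙 B) = n • φ (𝟙 B) := map_zsmul φ n (𝟙 B)
  have h1 : φ (𝟙 B) = LinearMap.id := tateModuleMap_id p B
  rw [h1] at h
  exact h

/-- **Step 1 (Faltings, Satz 4, with `End_ℚ(B) = ℤ`): the commutant of `T_p B` is `ℤ_p`.**
Granted `faltings_tate_bijective B B p`, every `Γ_ℚ`-equivariant `ℤ_p`-linear endomorphism of
`T_p B` lies in the `ℤ_p`-span of the `T_p f`, `f ∈ End_ℚ(B)`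
(`mem_span_range_tateModuleMap_of_faltings_tate_bijective`); if every `f` is `n · 𝟙_B` these are
the scalars. [cite: Faltings1983Endlichkeit, §5 Satz 4] -/
theorem exists_eq_smul_id_of_faltings (hF : faltings_tate_bijective B B p)
    (hEnd : ∀ f : B ⟶ B, ∃ n : ℤ, f = n • 𝟙 B)
    (T : B.tateModule p →ₗ[ℤ_[p]] B.tateModule p)
    (hT : ∀ (σ : Field.absoluteGaloisGroup ℚ) (a : B.tateModule p), T (σ • a) = σ • T a) :
    ∃ c : ℤ_[p], T = c • LinearMap.id := by
  have hmem := mem_span_range_tateModuleMap_of_faltings_tate_bijective p hF T hT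
  have hle : Submodule.span ℤ_[p] (Set.range (tateModuleMap p : (B ⟶ B) → _)) ≤
      Submodule.span ℤ_[p] {(LinearMap.id : B.tateModule p →ₗ[ℤ_[p]] B.tateModule p)} := by
    refine Submodule.span_le.2 ?_
    rintro _ ⟨f, rfl⟩
    obtain ⟨n, rfl⟩ := hEnd f
    rw [SetLike.mem_coe, tateModuleMap_zsmul_id]
    exact zsmul_mem (Submodule.mem_span_singleton_self _) n
  obtain ⟨c, hc⟩ := Submodule.mem_span_singleton.1 (hle hmem)
  exact ⟨c, hc.symm⟩

/-- **Step 2: the commutant of `V_p B` is `ℚ_p`** (granted `faltings_tate_bijective B B p` and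
`End_ℚ(B) = ℤ`).  A `Γ_ℚ`-equivariant `ℚ_p`-linear `T : V_p B → V_p B` restricted to the finitely
generated lattice `T_p B` (`module_finite_tateModule_of_cast_ne_zero`) has bounded denominators:
`s • T ∘ ι = ι ∘ φ` for some `s ∈ ℤ_p ∖ {0}` and a `ℤ_p`-linear `φ : T_p B → T_p B`
(`RationalTateModule.exists_linearMap_toRational_apply_eq_smul`), which is equivariant
(`smul_apply_of_toRational_apply_eq`), hence a scalar `c` (Step 1); so `s • T = c` on the
lattice, hence on `V_p B = ℚ_p ⊗ T_p B`, and `T = c / s`. (Faltings 1983, §5, Bemerkung: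
"`End_π(T_l ⊗ ℚ_l) = End_K(A) ⊗ ℚ_l`".) [cite: Faltings1983Endlichkeit, §5 Satz 4] -/
theorem exists_eq_smul_id_rationalTateRep (hF : faltings_tate_bijective B B p)
    (hEnd : ∀ f : B ⟶ B, ∃ n : ℤ, f = n • 𝟙 B)
    (T : B.rationalTateModule p →ₗ[ℚ_[p]] B.rationalTateModule p)
    (hT : ∀ g : Field.absoluteGaloisGroup ℚ,
      T ∘ₗ B.rationalTateRep p g = B.rationalTateRep p g ∘ₗ T) :
    ∃ c : ℚ_[p], T = c • LinearMap.id := by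
  haveI : Module.Finite ℤ_[p] (B.tateModule p) :=
    B.module_finite_tateModule_of_cast_ne_zero p (natCast_ne_zero_of_numberField (K := ℚ) p)
  -- the lattice map `x ↦ T (ι x)`
  let g : B.tateModule p →ₗ[ℤ_[p]] B.rationalTateModule p :=
    (T.restrictScalars ℤ_[p]) ∘ₗ TateModule.toRational p
  have hg : ∀ x, g x = T (TateModule.toRational p x) := fun x => rfl
  obtain ⟨s, hs, φ, hφ⟩ := RationalTateModule.exists_linearMap_toRational_apply_eq_smul p g
  have hgeq : ∀ (σ : Field.absoluteGaloisGroup ℚ) (x : B.tateModule p),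
      g (σ • x) = B.rationalTateRep p σ (g x) := by
    intro σ x
    have := LinearMap.congr_fun (hT σ) (TateModule.toRational p x)
    rw [LinearMap.comp_apply, LinearMap.comp_apply] at this
    rw [hg, hg, ← rationalTateRep_toRational p σ x]
    exact this
  have hφeq : ∀ (σ : Field.absoluteGaloisGroup ℚ) (x : B.tateModule p),
      φ (σ • x) = σ • φ x :=
    smul_apply_of_toRational_apply_eq p hφ hgeq
  obtain ⟨c, hc⟩ := exists_eq_smul_id_of_faltings p B hF hEnd φ hφeq
  -- on the lattice: `s • T (ι x) = c • ι x`
  have hlat : ∀ x : B.tateModule p,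
      (s : ℚ_[p]) • T (TateModule.toRational p x) = (c : ℚ_[p]) • TateModule.toRational p x := by
    intro x
    rw [← PadicInt.algebraMap_apply s, ← PadicInt.algebraMap_apply c, algebraMap_smul,
      algebraMap_smul, ← hg, ← hφ x, hc, LinearMap.smul_apply, LinearMap.id_apply, map_smul]
  -- extend from the lattice to `V_p B = ℚ_p ⊗ T_p B`
  have hsT : (s : ℚ_[p]) • T = (c : ℚ_[p]) • LinearMap.id := by
    refine TensorProduct.AlgebraTensorModule.ext fun a y => ?_
    have hay : (a ⊗ₜ[ℤ_[p]] y : ℚ_[p] ⊗[ℤ_[p]] B.tateModule p) =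
        a • ((1 : ℚ_[p]) ⊗ₜ[ℤ_[p]] y) := by
      rw [TensorProduct.smul_tmul', smul_eq_mul, mul_one]
    rw [hay]
    change ((s : ℚ_[p]) • T) (a • TateModule.toRational p y) =
      ((c : ℚ_[p]) • (LinearMap.id : B.rationalTateModule p →ₗ[ℚ_[p]] B.rationalTateModule p))
        (a • TateModule.toRational p y)
    rw [map_smul, map_smul, LinearMap.smul_apply, hlat y, LinearMap.smul_apply, LinearMap.id_apply]
  have hs0 : (s : ℚ_[p]) ≠ 0 := PadicInt.coe_ne_zero.2 hs
  refine ⟨(s : ℚ_[p])⁻¹ * (c : ℚ_[p]), ?_⟩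
  rw [mul_smul, ← hsT, smul_smul, inv_mul_cancel₀ hs0, one_smul]

/-- **Step 3: `V_p B` is irreducible** (granted Faltings' Satz 3 and Satz 4 for `(B, p)` and
`End_ℚ(B) = ℤ`), as soon as `V_p B ≠ 0`: semisimple with scalar commutant.
[cite: Faltings1983Endlichkeit, §5 Satz 3] -/
theorem isIrreducible_rationalTateRep (hF : faltings_tate_bijective B B p)
    (hS : isSemisimpleRepresentation_rationalTateRep B p)
    (hEnd : ∀ f : B ⟶ B, ∃ n : ℤ, f = n • 𝟙 B) [Nontrivial (B.rationalTateModule p)] :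
    (B.rationalTateRep p).IsIrreducible := by
  haveI : (B.rationalTateRep p).IsSemisimpleRepresentation := hS
  exact isIrreducible_of_isSemisimpleRepresentation_of_commutant _
    (exists_eq_smul_id_rationalTateRep p B hF hEnd)

/-- **Step 4: `V_p B` is absolutely irreducible** — its matrices in a basis `b` span `M_n(ℚ_p)`
(granted Faltings' Satz 3 and Satz 4 for `(B, p)` and `End_ℚ(B) = ℤ`).
[cite: Faltings1983Endlichkeit, §5 Satz 3–4] -/
theorem span_range_toMatrix_rationalTateRep_eq_top {n : ℕ} (hF : faltings_tate_bijective B B p)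
    (hS : isSemisimpleRepresentation_rationalTateRep B p)
    (hEnd : ∀ f : B ⟶ B, ∃ n : ℤ, f = n • 𝟙 B)
    (b : Module.Basis (Fin n) ℚ_[p] (B.rationalTateModule p)) (hn : 0 < n) :
    Submodule.span ℚ_[p]
        (Set.range fun g : Field.absoluteGaloisGroup ℚ =>
          LinearMap.toMatrix b b (B.rationalTateRep p g)) = ⊤ := by
  haveI : Nontrivial (B.rationalTateModule p) :=
    nontrivial_of_ne (b ⟨0, hn⟩) 0 (b.ne_zero ⟨0, hn⟩)
  haveI := isIrreducible_rationalTateRep p B hF hS hEnd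
  exact span_range_toMatrix_eq_top _ b (exists_eq_smul_id_rationalTateRep p B hF hEnd)

end Tate

/-! ## The stub -/

/-- **Stub 3i for the given `(p, B)`, conditional on Faltings' theorems for `(B, p)`.**  If
`ρ₀ : Γ_ℚ → GL₄(ℚ̄_p)` is the framed contragredient of `V_p B ⊗ ℚ̄_p` in the dual basis of `b`
(`ρ₀(g) = ([g⁻¹]_b ⊗ ℚ̄_p)ᵀ`, i.e. `ρ₀ ≅ H¹_ét(B_ℚ̄, ℚ̄_p)`) and `End_ℚ(B) = ℤ · id`, then `ρ₀` is
irreducible: the `[g]_b` span `M₄(ℚ_p)` (Step 4), so the `ρ₀(g)` span `M₄(ℚ̄_p)`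
(`span_range_transpose_map_inv_eq_top`), and a representation whose matrices span `M_n` is
irreducible (`isIrreducible_of_span_eq_top`). [cite: Faltings1983Endlichkeit, §5 Satz 3–4] -/
theorem stub_tateModuleIrreducible_of (p : ℕ) [Fact p.Prime] (B : AbelianVariety ℚ)
    (hF : Literature.AlgebraicGeometry.Motives.faltings_tate_bijective B B p)
    (hS : Literature.AlgebraicGeometry.Motives.isSemisimpleRepresentation_rationalTateRep B p)
    (b : Module.Basis (Fin 4) ℚ_[p] (B.rationalTateModule p))
    (ρ₀ : FramedGaloisRep ℚ (PadicAlgCl p) 4)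
    (hfr : ∀ g : Field.absoluteGaloisGroup ℚ,
      (ρ₀ g).val =
        ((LinearMap.toMatrix b b (B.rationalTateRep p g⁻¹)).map
          (algebraMap ℚ_[p] (PadicAlgCl p))).transpose)
    (hEnd : ∀ f : B ⟶ B, ∃ n : ℤ, f = n • 𝟙 B) :
    ρ₀.toGaloisRep.IsIrreducible := by
  have hspan := span_range_transpose_map_inv_eq_top (algebraMap ℚ_[p] (PadicAlgCl p)) _
    (span_range_toMatrix_rationalTateRep_eq_top p B hF hS hEnd b (by norm_num))
  have hrange : (fun g : Field.absoluteGaloisGroup ℚ =>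
      ((ρ₀.toMonoidHom g : GL (Fin 4) (PadicAlgCl p)) : Matrix (Fin 4) (Fin 4) (PadicAlgCl p))) =
      fun g => ((LinearMap.toMatrix b b (B.rationalTateRep p g⁻¹)).map
        (algebraMap ℚ_[p] (PadicAlgCl p)))ᵀ :=
    funext fun g => hfr g
  refine (FramedRep.isIrreducible_toContinuousRep_iff ρ₀).2 ?_
  change Representation.IsIrreducible
    ((glStdRepresentation (Fin 4) (PadicAlgCl p)).comp ρ₀.toMonoidHom)
  refine Literature.RepresentationTheory.Semisimple.isIrreducible_of_span_eq_top (by norm_num)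
    ρ₀.toMonoidHom ?_
  rw [hrange]
  exact hspan

/-- **Stub 3i (`stub_tateModuleIrreducible`), the registered signature with Faltings' two theorems
prepended as hypotheses** (tree NAMED FACTS `Literature.AlgebraicGeometry.Motives.faltings_tate_bijective`
— Satz 4 / Korollar 1 — and `Literature.AlgebraicGeometry.Motives.isSemisimpleRepresentation_rationalTateRep`
— Satz 3 —, both unproved in the tree).  `B/ℚ` an abelian variety with `End_ℚ(B) = ℤ · id`, `ρ₀`
its framed `p`-adic `H¹` in the dual basis of a `ℚ_p`-basis `b` of `V_p B`; then `ρ₀` is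
irreducible (indeed absolutely: `V_p B` is semisimple with commutant `End_ℚ(B) ⊗ ℚ_p = ℚ_p`).
[cite: Faltings1983Endlichkeit, §5 Satz 3–4] -/
theorem stub_tateModuleIrreducible :
    (∀ (p : ℕ) [Fact p.Prime] (B : AbelianVariety ℚ),
        Literature.AlgebraicGeometry.Motives.faltings_tate_bijective B B p) →
    (∀ (p : ℕ) [Fact p.Prime] (B : AbelianVariety ℚ),
        Literature.AlgebraicGeometry.Motives.isSemisimpleRepresentation_rationalTateRep B p) →
    ∀ (p : ℕ) [Fact p.Prime] (B : AbelianVariety ℚ)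
      (b : Module.Basis (Fin 4) ℚ_[p] (B.rationalTateModule p)) (ρ₀ : FramedGaloisRep ℚ (PadicAlgCl p) 4),
      (∀ g : Field.absoluteGaloisGroup ℚ,
        (ρ₀ g).val =
          ((LinearMap.toMatrix b b (B.rationalTateRep p g⁻¹)).map
            (algebraMap ℚ_[p] (PadicAlgCl p))).transpose) →
      (∀ f : B ⟶ B, ∃ n : ℤ, f = n • 𝟙 B) →
      ρ₀.toGaloisRep.IsIrreducible :=
  fun hF hS p _ B b ρ₀ hfr hEnd =>
    stub_tateModuleIrreducible_of p B (hF p B) (hS p B) b ρ₀ hfr hEnd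

end Summit.Langlands.Langlands.Cruxes.StableYoshidaCongruence.LevelThreeWeierstrassSwitch
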